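/-
Copyright: statement-level skeleton of a published paper (lit-balaban cell, Phase-2 proof seat p30, gen 2). No proof
claims beyond what the kernel checks below.
-/
import Mathlib

/-!
# `BalabanImbrieJaffe1984to88.BIJ85Eq634Proof` — T. Bałaban, J. Imbrie, A. Jaffe, *Renormalization of the Higgs model:
minimizers, propagators and the stability of mean field theory*, Commun. Math. Phys. **97** (1985) 299–329
[BalabanImbrieJaffe1985]: Sect. 6.3 p. 320 — **(6.3.3) ⇒ (6.3.4)**: the scalar-field integral rewritten through the decomposition
(6.3.1) of u_k and the gauge invariance (6.3.2), PROVED as the unitary change of variables φ ↦ e^{iω}φ in the finite-dimensional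
scalar-field integral (Lebesgue measure preserved by a linear isometry), with (6.3.1), (6.3.2) and (2.8) as hypotheses in
abstract form

statement-level skeleton of published theorems with citation tags; proofs where landed; nothing here is a claim about the Yang–Mills mass gap

PDF held: `paper:balaban1985-cmp97-bij-higgs-minimizers` (journal page = PDF page + 298).  Render read as an image: p. 320
(`HOME/lit-balaban-r15/pages/1985-cmp97-bij-higgs-minimizers-p022-x2.png`).

CITATION HEADER (lean-in-tree rule).  Part of the lit-balaban TYPED SKELETON (HOME `run/shared/lean/pub/lit-balaban/`): WHAT IS
REPRODUCED = the members (6.3.3)–(6.3.4) of row **C1.Eq6.3.1-6.3.4** of `HOME/lit-balaban-r15/ROWS-C1-part2.md` (`typed p243553`;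
its member (6.3.1) is p30 gen 1's `BIJ85Eq625Proof.eq625`; (6.3.2) is the invariance the paper states *"we do not prove … here"* —
it stays a HYPOTHESIS); fifth file of seat p30 gen 2; unit `lit-balaban-p30`.

THE PRINTED TEXT (verbatim, p. 320 [PDF 22]).  *"6.3. Scalar Field Renormalization.  In Sect. 6.2 we established the general
decomposition (6.2.5) for u_k, u_k = u_{k+1}e^{ie_kηH_kB}e^{iη∂ω}, (6.3.1) where ω denotes the gauge transformation (6.2.6). This gauge
transformation does not influence the gauge field quadratic form σ_k, since this form is fully gauge invariant. More generally,
expressions involving only the gauge field are gauge invariant, so we must discuss the scalar field part of the action.  In that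
case, the form Δ_k(u_k) does depend on the gauge transformation ω. Our procedure for constructing S_k has the general invariance
S_k(u_ke^{−iη∂λ}, e^{iλ}φ) = S_k(u_k, φ) (6.3.2) for a gauge transformation λ. While we do not prove this invariance here, it is clear
in the case of the quadratic forms for which we write explicit formulas.  The scalar field integral has the form ∫𝒟φ exp{−[S_k(u_k,φ)
+ ½a‖ψ − Q(u_k)φ‖²]}. (6.3.3)  If we apply the decomposition (6.3.1) for u_k, and the gauge invariance (6.3.2), then (6.3.3) becomes
∫𝒟φ exp(−[S_k(u_{k+1}e^{ie_kηH_kB}, φ) + ½a‖e^{−iω}ψ − Q(u_{k+1}e^{ie_kηH_kB})φ‖²]). (6.3.4)"*  And (2.8) p. 303: *"Q commutes with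
gauge transformations, (Qφ)^h = Qφ^h. (2.8)"*.

THE TYPING.  The η-lattice scalar fields φ form a finite-dimensional real inner product space `Φ` (the complex field under Re⟨·,·⟩)
with 𝒟φ = its Lebesgue (`volume`) measure; the unit-lattice fields ψ a real normed space `Ψ`; gauge-field configurations u a type
`U`; the gauge transformations a group `Γ` acting on `U` (`•`, u ↦ u^h, the action of (2.7); in (6.3.1)–(6.3.2) written
multiplicatively, u ↦ ue^{−iη∂λ}) and by LINEAR ISOMETRIES on `Φ` and `Ψ` (`ρΦ`, `ρΨ` : Γ →* (· ≃ₗᵢ[ℝ] ·), φ ↦ e^{iλ}φ, ψ ↦ e^{iλ}ψ);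
S_k = any function `S : U → Φ → ℝ`, Q(u) = any `Q : U → Φ → Ψ`, a ∈ ℝ, ψ ∈ Ψ.  Hypotheses, verbatim in this vocabulary: (6.3.2)
`h632 : S (h • u) (ρΦ h φ) = S u φ`; (2.8) `h28 : Q (h • u) (ρΦ h φ) = ρΨ h (Q u φ)`; (6.3.1) `h631 : uk = h • u'` with u' :=
u_{k+1}e^{ie_kηH_kB} and h := the gauge transformation e^{iη∂ω} of (6.3.1).  WHAT IS PROVED: **`eq634`** — (6.3.3) = (6.3.4) with
e^{−iω}ψ rendered as (ρΨ h)⁻¹ψ (TRANSCRIPT NOTE T8: whether the element h carrying u' to u_k = u'e^{iη∂ω} acts on ψ as e^{iω} or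
e^{−iω} is a sign convention of (2.7)/(6.2.6) the abstract statement does not fix; the printed e^{−iω} is h⁻¹ for h ↔ e^{iω}); the
mechanism is `integrand_eq` (pointwise rewriting of the integrand by (6.3.1), (6.3.2), (2.8) and the isometry of ρΨ) +
`MeasureTheory.MeasurePreserving.integral_comp` for the linear isometry ρΦ h⁻¹ (Mathlib `LinearIsometryEquiv.measurePreserving`).
Carrier clauses (F6): S_k, Q(u), the actions and the lattice are instance data; (6.3.2) is NOT proved (as in print); NOTHING of
the paper is asserted beyond the kernel-checked statements below.
-/

open MeasureTheory

namespace Literature.MathematicalPhysics.QuantumFieldTheory.BalabanImbrieJaffe1984to88.BIJ85Eq634Proof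

variable {Φ : Type*} [NormedAddCommGroup Φ] [InnerProductSpace ℝ Φ]
variable {Ψ : Type*} [NormedAddCommGroup Ψ] [NormedSpace ℝ Ψ]
variable {U Γ : Type*} [Group Γ] [MulAction Γ U]
variable (ρΦ : Γ →* (Φ ≃ₗᵢ[ℝ] Φ)) (ρΨ : Γ →* (Ψ ≃ₗᵢ[ℝ] Ψ))
variable (S : U → Φ → ℝ) (Q : U → Φ → Ψ) (a : ℝ) (ψ : Ψ)

/-- The action of h followed by h⁻¹ on φ is the identity (ρΦ is a homomorphism). [cite: BalabanImbrieJaffe1985, (6.3.2) p.320] -/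
theorem rho_mul_inv_apply (h : Γ) (φ : Φ) : ρΦ h (ρΦ h⁻¹ φ) = φ := by
  have e : ρΦ h * ρΦ h⁻¹ = 1 := by rw [← map_mul, mul_inv_cancel, map_one]
  have e' := congrArg (fun T : Φ ≃ₗᵢ[ℝ] Φ => T φ) e
  simpa only [LinearIsometryEquiv.coe_mul, Function.comp_apply, LinearIsometryEquiv.coe_one, id_eq] using e'

/-- The same for ψ. [cite: BalabanImbrieJaffe1985, (6.3.2) p.320] -/
theorem rhoPsi_mul_inv_apply (h : Γ) (x : Ψ) : ρΨ h (ρΨ h⁻¹ x) = x := by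
  have e : ρΨ h * ρΨ h⁻¹ = 1 := by rw [← map_mul, mul_inv_cancel, map_one]
  have e' := congrArg (fun T : Ψ ≃ₗᵢ[ℝ] Ψ => T x) e
  simpa only [LinearIsometryEquiv.coe_mul, Function.comp_apply, LinearIsometryEquiv.coe_one, id_eq] using e'

/-- The POINTWISE step of (6.3.3) ⇒ (6.3.4), p. 320: with u_k = h • u' ((6.3.1)), the invariance (6.3.2) and the covariance (2.8),
S_k(u_k, φ) + ½a‖ψ − Q(u_k)φ‖² = S_k(u', φ') + ½a‖h⁻¹ψ − Q(u')φ'‖² at φ' = h⁻¹φ (the gauge-transformed integration variable).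
[cite: BalabanImbrieJaffe1985, (6.3.4) p.320] -/
theorem integrand_eq (h632 : ∀ (h : Γ) (u : U) (φ : Φ), S (h • u) (ρΦ h φ) = S u φ)
    (h28 : ∀ (h : Γ) (u : U) (φ : Φ), Q (h • u) (ρΦ h φ) = ρΨ h (Q u φ))
    (h : Γ) (u' uk : U) (h631 : uk = h • u') (φ : Φ) :
    S uk φ + (1 / 2 : ℝ) * a * ‖ψ - Q uk φ‖ ^ 2
      = S u' (ρΦ h⁻¹ φ) + (1 / 2 : ℝ) * a * ‖ρΨ h⁻¹ ψ - Q u' (ρΦ h⁻¹ φ)‖ ^ 2 := by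
  have hS : S uk φ = S u' (ρΦ h⁻¹ φ) := by
    rw [h631, ← h632 h u' (ρΦ h⁻¹ φ), rho_mul_inv_apply]
  have hQ : Q uk φ = ρΨ h (Q u' (ρΦ h⁻¹ φ)) := by
    rw [h631, ← h28 h u' (ρΦ h⁻¹ φ), rho_mul_inv_apply]
  have hnorm : ‖ψ - Q uk φ‖ = ‖ρΨ h⁻¹ ψ - Q u' (ρΦ h⁻¹ φ)‖ := by
    rw [hQ]
    conv_lhs => rw [← rhoPsi_mul_inv_apply ρΨ h ψ]
    rw [← map_sub, LinearIsometryEquiv.norm_map]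
  rw [hS, hnorm]

variable [FiniteDimensional ℝ Φ] [MeasurableSpace Φ] [BorelSpace Φ]

/-- **(6.3.3) ⇒ (6.3.4)** p. 320 [PDF 22], verbatim: *"The scalar field integral has the form ∫𝒟φ exp{−[S_k(u_k,φ) + ½a‖ψ −
Q(u_k)φ‖²]}. (6.3.3) If we apply the decomposition (6.3.1) for u_k, and the gauge invariance (6.3.2), then (6.3.3) becomes ∫𝒟φ
exp(−[S_k(u_{k+1}e^{ie_kηH_kB}, φ) + ½a‖e^{−iω}ψ − Q(u_{k+1}e^{ie_kηH_kB})φ‖²]). (6.3.4)"* — PROVED: with u_k = h • u' ((6.3.1), u' =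
u_{k+1}e^{ie_kηH_kB}, h the gauge transformation generated by ω), the invariance (6.3.2) `h632` and the covariance (2.8) `h28` as
hypotheses, the two integrals agree, e^{−iω}ψ being (ρΨ h)⁻¹ψ (TRANSCRIPT NOTE T8); the Lebesgue measure 𝒟φ is preserved by the
linear isometry φ ↦ e^{iω}φ. [cite: BalabanImbrieJaffe1985, (6.3.3)–(6.3.4) p.320] -/
theorem eq634 (h632 : ∀ (h : Γ) (u : U) (φ : Φ), S (h • u) (ρΦ h φ) = S u φ)
    (h28 : ∀ (h : Γ) (u : U) (φ : Φ), Q (h • u) (ρΦ h φ) = ρΨ h (Q u φ))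
    (h : Γ) (u' uk : U) (h631 : uk = h • u') :
    ∫ φ : Φ, Real.exp (-(S uk φ + (1 / 2 : ℝ) * a * ‖ψ - Q uk φ‖ ^ 2))
      = ∫ φ : Φ, Real.exp (-(S u' φ + (1 / 2 : ℝ) * a * ‖ρΨ h⁻¹ ψ - Q u' φ‖ ^ 2)) := by
  simp_rw [integrand_eq ρΦ ρΨ S Q a ψ h632 h28 h u' uk h631]
  exact ((ρΦ h⁻¹).measurePreserving).integral_comp (ρΦ h⁻¹).toHomeomorph.measurableEmbedding
    (fun φ : Φ => Real.exp (-(S u' φ + (1 / 2 : ℝ) * a * ‖ρΨ h⁻¹ ψ - Q u' φ‖ ^ 2)))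

end Literature.MathematicalPhysics.QuantumFieldTheory.BalabanImbrieJaffe1984to88.BIJ85Eq634Proof
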